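import Mathlib
import HarnessLib
import HarnessLib.Audit
import Summits.AtomisticToContinuum.Statement

/-!
Route: RingingRung

CLOSED (retired) 2026-08-15T13:46:16Z by operator:999:1257524 — reason: not-a-thesis: assembly does not conclude the sub-problem Statement — note: D-0027 §2.1 audit (human 2026-08-15: routes that do not decide the summit are removed): the assembly concludes `StroboscopicRung`, not the sub-problem statement; a NEW conforming route may be opened from the same idea (generated `closes : … → _root_.HydrodynamicLimit`).. The file is kept as the record of this route; refuted decls are indexed as negative knowledge (`ledger negatives`).

# Route RingingRung — The ringing rung — Temple–Young pure tones are T = ∞ nonlinear Euler data; the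
hard-sphere gas must return at every period, scored by an exact linear entropy statistic against the
INITIAL law

SPECIAL-DATA RUNG (declared; precedent HomoenergeticRung / SabraStatics: the Assembly closes the
rung target StroboscopicRung; the frame "rung → HydrodynamicLimit" is NOT claimed — the rung is a
necessary condition, the benchmark every engine for time-dependent references must pass). Realises
card temple-young-ringing-rung. It suffices to show X = StroboscopicRung := PureTonesExist ∧
NodeReturn.
PureTonesExist (crux 3, typed): there are K > 0 and σ₁ > 0 such that for EVERY reduced density 0 < σ
< σ₁ the hard-sphere compressible Euler system on 𝕋³ (equation of state p = ρθZ(ρσ³), e = 3θ/2 — the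
conjunct's own IsHardSphereEulerSolution) carries a GLOBAL classical solution (ρ, u, θ) (T = ∞: a
solution on [0, T) for every T > 0) that is time-periodic with some period τ > 0, starts AT REST
(u(0,·) ≡ 0), is NOT stationary, has unit mass and K⁻¹ ≤ ρ(0,·), θ(0,·) ≤ K: a Temple–Young "pure
tone" (finite-amplitude shock-free nonlinear sound on a non-isentropic quiet state; arXiv:2406.00200
Thm 1.4, extended planarly to 𝕋³) for the hard-sphere gas.
NodeReturn (second conjunct of the target, typed inline): there is η₀ > 0 such that for every σ > 0,
all continuous local-Gibbs profiles (a₀ > 0, u₀, θ₀ > 0) obeying the DILUTENESS CAP a₀(x)σ³ ≤ η₀∫a₀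
(⇒ σ³ ≤ η₀ and local packing ≲ η₀ everywhere), every period τ > 0, every global classical hs-Euler
solution (ρ, u, θ) with (ρ, u, θ)(t + τ) = (ρ, u, θ)(t), and every family of hard-sphere flows: if
the local Gibbs laws are probability measures and their empirical fields at time 0 converge in
probability to (ρ, ρu, E)(0), then at EVERY NODE t = nτ, n ∈ ℕ, the empirical density, momentum and
energy fields of the deterministically evolved spheres converge in probability to (ρ, ρu, E)(nτ) =
(ρ, ρu, E)(0) — the conjunct's conclusion for T = ∞ periodic data at the stroboscopic times,
σ-uniformly under the cap (steady data included: for them every τ is a period, so NodeReturn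
contains the hydrostatic and plane-shear rungs at ALL times).
The meter is exact: with Λ(z) := ∫ log(localGibbsProfile a₀ u₀ θ₀) d(empiricalMeasure z) and D_N(t)
:= E_P₀[Λ] − E_P₀[Λ ∘ Φ_t] one has H(lawAt P₀ t ‖ P₀) = (N+1)·D_N(t) at every N
(StroboscopicIdentity: Liouville + linearity of log f₀ in the empirical measure; no partition
function, no o(N)), and NodeReturn ⟺ D_N(nτ) → 0 (cruxes ReturnDeficitVanishes +
DeficitControlsFields one way, support FieldsControlDeficit the other).
Lean: `open Literature.MathematicalPhysics.KineticTheory Literature.Analysis.FluidPDE MeasureTheory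
Filter Topology in PureTonesExist ∧ ∃ η₀ : ℝ, 0 < η₀ ∧ ∀ σ : ℝ, 0 < σ → ∀ (a₀ θ₀ : T3 → ℝ) (u₀ : T3
→ V3), Continuous a₀ → Continuous θ₀ → Continuous u₀ → (∀ x, 0 < a₀ x) → (∀ x, 0 < θ₀ x) → (∀ x, a₀
x * σ ^ 3 ≤ η₀ * ∫ y, a₀ y) → ∀ τ : ℝ, 0 < τ → ∀ (ρ θ : ℝ → T3 → ℝ) (u : ℝ → T3 → V3), (∀ T : ℝ, 0 <
T → IsHardSphereEulerSolution σ T ρ u θ) → (∀ t x, ρ (t + τ) x = ρ t x ∧ u (t + τ) x = u t x ∧ θ (t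
+ τ) x = θ t x) → ∀ Φ : (N : ℕ) → HardSphereFlow (Torus.geometry (Fin 3)) (hsDiameter σ N) (N + 1),
(∀ N, IsProbabilityMeasure (localGibbsLaw σ a₀ u₀ θ₀ N (Φ N))) → TendstoHydroFieldsAt (fun N =>
localGibbsLaw σ a₀ u₀ θ₀ N (Φ N)) Φ ρ u θ 0 → ∀ n : ℕ, TendstoHydroFieldsAt (fun N => localGibbsLaw
σ a₀ u₀ θ₀ N (Φ N)) Φ ρ u θ (n * τ)`

## Assembly
Pure logic plus periodicity, PROVED in the planner's Sketch.lean (theorem assembly_holds, 30 lines,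
lean check rc 0, axioms propext / Classical.choice / Quot.sound): take η₀ := min of the two caps
(the cap is monotone in η₀ because ∫a₀ ≥ 0); given capped data, a τ-periodic global solution, flows,
probability laws and time-0 matching, ReturnDeficitVanishes gives D_N(nτ) → 0; DeficitControlsFields
at t = nτ with (r, w, ϑ) := (ρ(0), u(0), θ(0)) (the time-0 hypothesis is definitionally the
matching) gives convergence of the time-nτ fields to the time-0 Euler fields; periodicity (induction
on n: ρ(nτ) = ρ(0), u(nτ) = u(0), θ(nτ) = θ(0)) rewrites them as (ρ, ρu, E)(nτ). PureTonesExist is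
carried into the first conjunct. The route is a rung: StroboscopicRung does not imply
Literature.MathematicalPhysics.KineticTheory.HydrodynamicLimit and no item claims it; conversely
HydrodynamicLimit as typed (σ₀ depending on the profiles) yields only the profile-first shadow of
NodeReturn (trivially: t = nτ ∈ [0, nτ + 1)), recorded not filed, while the σ-uniform capped
NodeReturn is what the conjunct's proof engines would actually deliver (their σ₀ depends on sup a₀σ³
only).

Rationale: WHY THIS LINE. Temple–Young (TempleYoung2023 = arXiv:2305.15623; TempleYoung2024 = arXiv:2406.00200,
Thms 1.3–1.5, Cor. 1.2; programme doi:10.4310/maa.2009.v16.n3.a5, doi:10.1137/080739604,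
doi:10.1007/s10915-014-9851-z) proved that 3×3 compressible Euler with a general constitutive law
v(p, s), v_p < 0, and a generic non-resonant entropy profile carries one-parameter families of
space- and time-periodic shock-free "pure tone" solutions with p even and u odd in t (so the t = 0
state is at rest: exactly a local Gibbs datum (a₀, 0, θ₀)); every other T = ∞ datum on the board is
steady or small-amplitude, and Glimm–Lax decay (GlimmLax1970) makes this the ONLY known genuinely
nonlinear, non-steady, non-self-similar classical Euler class that never shocks. Because Euler
returns to its initial state at every t = nτ, the natural Yau reference there is the INITIAL law
itself, and Liouville's theorem turns the relative entropy H(f_nτ ‖ f₀) into (N+1) times a LINEAR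
statistic of the expected empirical fields (Sasa2014, Gaspard2022 §3.2 lineage; Yau1991,
OllaVaradhanYau1993, KipnisLandim1999 App. 1 §8 for the entropy inequality; Kosygina
doi:10.1214/aop/1015345597 for specific relative entropy along a hydrodynamic evolution):
macroscopic recurrence without microscopic recurrence (Zermelo answered on an O(1) time scale),
certified by pairings of density, momentum and kinetic energy against fixed smooth weights. Imported
areas: nonlinear acoustics / bifurcation with small divisors (PDE: the data class and its existence
theory), information theory (exact KL identity, Csiszár–Pinsker-type entropy inequality,
Csiszar1975), low-density equilibrium statistical mechanics (cluster expansions: σ-uniform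
exponential LLN and the inverse density–activity map, Ruelle1969 Ch. 4, LebowitzPenrose1964,
PulvirentiTsagkarogiannis2012), and the kinetic contrast (the H-theorem forbids time-periodic
Boltzmann/Enskog solutions on the torus, CercignaniIllnerPulvirenti1994 §3: perpetual ringing is a
Kn = 0 phenomenon, so no kinetic intermediate can pass the rung — DiluteRegimeBarrier is
sidestepped, not crossed). What no prior route or negative (index empty) does: a T = ∞ NON-STEADY
finite-amplitude benchmark with an exact finite-N success functional and a PROVED pure-logic
assembly (Sketch.lean, theorem assembly_holds, axioms propext/choice/Quot.sound); and a quantifier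
lesson recorded in § Numbers: an exact special-data rung cannot be both profile-first (as the
conjunct) and σ-robust unless the data are EOS-free, hence the σ-uniform activity-capped form.

RANKED CRUXES. #0 StroboscopicRung (target) — X = PureTonesExist ∧ NodeReturn as in § Thesis
(NodeReturn typed inline: σ-uniform, activity-capped stroboscopic return of the three empirical
fields along every time-periodic global classical hs-Euler solution, steady ones included). (why it
might fail: Conjunction: fails if C^∞ tones do not exist for the hs EOS (regularity gap in TY) or if
the deterministic gas damps/detunes a tone by O(1) per period at Euler scale; non-vacuity on actual
tones is RungBites.) [TempleYoung2024, arXiv:2406.00200, Spohn1991, Yau1991]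
#2 ReturnDeficitVanishes (crux) — THE RUNG IN ITS EXACT-METER FORM (card crux 1). There is η₀ > 0
such that for every σ > 0, all continuous profiles a₀ > 0, u₀, θ₀ > 0 with a₀(x)σ³ ≤ η₀∫a₀, every τ
> 0, every global classical hs-Euler solution (ρ, u, θ) that is τ-periodic in time, and every family
of hard-sphere flows Φ_N: if the local Gibbs laws P_N = localGibbsLaw σ a₀ u₀ θ₀ N (Φ N) are
probability measures and their time-0 fields converge to (ρ, ρu, E)(0), then for every n ∈ ℕ the
return deficit D_N(nτ) := E_P_N[Λ] − E_P_N[Λ ∘ flow(nτ)] → 0 as N → ∞, where Λ(z) = ∫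
log(localGibbsProfile a₀ u₀ θ₀) d(empiricalMeasure z) = (N+1)⁻¹ Σᵢ [log a₀(xᵢ) − (3/2)log 2πθ₀(xᵢ) −
|vᵢ − u₀(xᵢ)|²/2θ₀(xᵢ)]. By StroboscopicIdentity this says exactly N⁻¹H(f_nτ ‖ f₀) → 0: the time-nτ
law is indistinguishable from the initial law by all local observables at specific-entropy
resolution, while Φ_nτ z is nowhere near z. [difficulty: open-problem] (why it might fail: It IS the
conjunct for T = ∞ periodic data at the nodes (σ-uniform under the cap): false iff the deterministic
gas attenuates or detunes a finite-amplitude tone by O(1) per period at Euler scale (anomalous sound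
absorption), or if σ-uniformity near η₀ fails.) [TempleYoung2024, arXiv:2406.00200, TempleYoung2023,
Spohn1991, Yau1991, Sasa2014, OllaVaradhanYau1993]
#3 PureTonesExist (crux) — TEMPLE–YOUNG FOR THE HARD-SPHERE EQUATION OF STATE (card crux 2), in the
conjunct's regularity. ∃ K > 0, σ₁ > 0 such that for every 0 < σ < σ₁ there are τ > 0 and (ρ, u, θ)
with: IsHardSphereEulerSolution σ T ρ u θ for every T > 0 (global, jointly C^∞, ρ, θ > 0); (ρ, u,
θ)(t + τ, ·) = (ρ, u, θ)(t, ·) for all t; u(0, ·) ≡ 0 (rest data: TY symmetry (2.3), p even / u odd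
in t); not stationary (∃ t x, ρ(t, x) ≠ ρ(0, x)); ∫ρ(0) = 1; K⁻¹ ≤ ρ(0, ·), θ(0, ·) ≤ K uniformly in
σ. Intended construction: the hs EOS in TY's Lagrangian form v = v(p, s) (s = (3/2)log θ − log ρ −
f_ex(ρσ³) + c, v_p < 0, genuinely nonlinear at small packing since Z → 1, γ = 5/3), a fixed smooth
1-periodic non-resonant entropy profile of x₁ (TY Thm 1.5 genericity), mode k, small amplitude α ≠
0, planar extension to 𝕋³; mass normalised to 1 (rescaling ρ ↦ λρ maps σ-solutions to
σλ^(−1/3)-solutions). [deps: HsEosLowDensity] [difficulty: L] (why it might fail: TY Thm 1.4 gives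
continuous piecewise-H^b tones for each b > 5/2 on |α| < α_k(b), not C^∞ at one fixed amplitude as
IsHardSphereEulerSolution demands; needs a b-uniform (tame or analytic-class) IFT, Z analytic
(HsEosLowDensity) and genuine nonlinearity of the hs EOS.) [TempleYoung2024, arXiv:2406.00200,
TempleYoung2023, doi:10.4310/maa.2009.v16.n3.a5, doi:10.1007/s10915-014-9851-z, LebowitzPenrose1964,
Ruelle1969]
#4 DeficitControlsFields (crux) — A VANISHING DEFICIT PINS THE FIELDS (the ⇒ half of the card's
"stroboscopic HL ⟺ D_N = o(1)"). ∃ η₀ > 0 such that for every σ > 0, all continuous profiles a₀ > 0,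
u₀, θ₀ > 0 with a₀(x)σ³ ≤ η₀∫a₀ and every family of flows: if the P_N are probability measures and
D_N(t) → 0 at some time t, then for every triple of limit profiles (r, w, ϑ), convergence in
probability of the time-0 empirical fields to (∫χr, ∫χr·w, ∫χE(r, w, ϑ)) implies the same
convergence for the fields of the time-t configurations. Route: H(lawAt P_N t ‖ P_N) = (N+1)D_N(t) =
o(N) (StroboscopicIdentity) + exponential concentration of the three fields under P_N, uniform over
the capped class (DiluteGibbsConcentration) + the entropy inequality μ(A) ≤ (log 2 + H(μ‖λ))/log(1 +
1/λ(A)) (KipnisLandim1999 App. 1 Prop. 8.2) with λ = P_N, μ = lawAt P_N t, and μ(field ∘ id ∈ ·) =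
P_N(field ∘ flow t ∈ ·) (measurable_flow). No dynamics beyond measure preservation. [deps:
StroboscopicIdentity, DiluteGibbsConcentration] [difficulty: M] (why it might fail: Needs
exponential (not polynomial) concentration of all three fields under canonical local Gibbs laws
UNIFORMLY over the activity-capped class — η₀ must sit inside the canonical cluster-expansion radius
— and klDiv(lawAt‖P₀) = (N+1)D exactly (lawAt ≪ P₀ via Liouville and a₀ > 0).) [KipnisLandim1999,
Yau1991, OllaVaradhanYau1993, Ruelle1969, PulvirentiTsagkarogiannis2012, Csiszar1975]
#9 StroboscopicIdentity (support) — THE EXACT METER (card Mechanism 1; one lemma for this card and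
its companion loschmidt-is-zermelo-at-double-time). For σ > 0, continuous profiles a₀ > 0, u₀, θ₀ >
0, every N, every hard-sphere flow Φ and every t ∈ ℝ: if P₀ = localGibbsLaw σ a₀ u₀ θ₀ N Φ is a
probability measure then klDiv (Φ.lawAt P₀ t) P₀ is finite and its real value equals (N+1)·(E_P₀[Λ]
− E_P₀[Λ ∘ Φ.flow t]). Proof: P₀ = Z⁻¹𝟙_D ∏ g₀(zᵢ) dz with log ∏ g₀ = (N+1)Λ; lawAt P₀ t = (f₀ ∘
Φ_(−t)) dz (lawAt_withDensity, measurePreserving); H = ∫ f_t log f_t − ∫ f_t log f₀ = ∫ f₀ log f₀ −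
∫ f_t log f₀ (Liouville) = (N+1)(E₀Λ − E_tΛ), log Z cancelling; integrability from Gaussian velocity
moments and energy conservation (configEnergy_eq). [difficulty: M] [Sasa2014, Gaspard2022, GST2013,
Spohn1991]
#9 ReturnDeficitNonneg (support) — TEETH AT FINITE N: for the same data and every t, 0 ≤ D_N(t) =
E_P₀[Λ] − E_P₀[Λ ∘ Φ.flow t] (Gibbs' inequality E_f_t[log f₀] ≤ E_f_t[log f_t] = E_f₀[log f₀];
corollary of StroboscopicIdentity). The MD-checkable positivity of the "initial dissipation
function"; with rest data t ↦ D_N(t) is moreover even (velocity reversal), recorded not filed.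
[difficulty: provable-now] [Csiszar1975, Sasa2014, GST2013]
#9 FieldsControlDeficit (support) — THE ⇐ HALF (no cap, no small σ): for σ > 0, continuous profiles,
any flows with P_N probability measures, any t and any limit profiles (r, w, ϑ): if the empirical
fields converge in probability to (∫χr, ∫χr·w, ∫χE(r,w,ϑ)) both at time 0 and at time t, then D_N(t)
→ 0. Λ is the density field against log a₀ − (3/2)log 2πθ₀ − |u₀|²/2θ₀, plus the momentum field
against u₀/θ₀, minus the energy field against 1/θ₀ (all continuous weights); expectations converge
by uniform integrability, which energy conservation (Σ|vᵢ(t)|² = Σ|vᵢ(0)|²) transfers from the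
Gaussian time-0 law. Hence NodeReturn ⟹ ReturnDeficitVanishes: the two forms of the rung are
equivalent. [difficulty: M] [Spohn1991, OllaVaradhanYau1993]
#9 DiluteGibbsConcentration (support) — σ-UNIFORM EXPONENTIAL LLN FOR DILUTE LOCAL GIBBS LAWS
(capped twin of LocalGibbsConcentration 0767, which is profile-first): ∃ η₀ > 0, ∀ σ > 0, for all
continuous a > 0, u₀, θ₀ > 0 with a(x)σ³ ≤ η₀∫a there is a continuous ρ₀ > 0 (equilibrium density at
activity a, diameter σ) such that the laws localGibbsLaw σ a u₀ θ₀ N Φ are probability measures for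
all N, Φ and P(|field − limit| > δ) ≤ C e^(−(N+1)/C) for the density, momentum and energy fields
against every continuous χ, C = C(χ, δ, profiles) uniform in N and Φ. Canonical cluster expansion at
packing ≲ η₀ (integrating the cap gives σ³ ≤ η₀) + Gaussian velocities. [difficulty: L] [Ruelle1969,
LebowitzPenrose1964, PulvirentiTsagkarogiannis2012, Spohn1991]
#9 HsEosLowDensity (support) — Shared verbatim with stmt-AtomisticToContinuum-0768
(RelEntropyErgodic.HsEosLowDensity and four other routes): the excess free energy hsExcessFreeEnergy
is a genuine limit and real-analytic on [0, η₀) with F(0) = 0, F′(0) = 2π/3, so Z(η) =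
hsCompressibility is analytic, Z = 1 + (2π/3)η + O(η²): the smooth constitutive law PureTonesExist
feeds into Temple–Young. [difficulty: L] [Ruelle1969, LebowitzPenrose1964]
#9 LocalGibbsRealisation (support) — INVERSE LLN (every bounded continuous state is dilute
local-Gibbs data, uniformly): ∀ K > 0 ∃ σ₁ > 0 ∀ 0 < σ < σ₁, for all continuous (ρ₀, u₀, θ₀) with
K⁻¹ ≤ ρ₀ ≤ K, ∫ρ₀ = 1, θ₀ > 0 there is a continuous activity a₀ > 0 with a₀ ≤ 2K∫a₀ such that for
every family of flows the laws localGibbsLaw σ a₀ u₀ θ₀ N (Φ N) are probability measures and their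
time-0 fields converge in probability to (ρ₀, ρ₀u₀, ρ₀(|u₀|²/2 + 3θ₀/2)). Inversion of the
density–activity series ρ = a(1 − (4π/3)aσ³ + …) (canonical, normalised) by contraction, uniform on
the K-class; with DiluteGibbsConcentration it certifies that the tones of PureTonesExist are
admissible capped data for σ small (RungBites). [difficulty: M] [PulvirentiTsagkarogiannis2012,
LebowitzPenrose1964, Ruelle1969]
#9 RungBites (support) — THE TARGET BITES ON AN ACTUAL TONE (non-vacuity, pure bookkeeping):
StroboscopicRung → LocalGibbsRealisation → there exist σ > 0, τ > 0, a non-stationary τ-periodic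
global classical hs-Euler solution (ρ, u, θ) at rest at t = 0 and continuous profiles a₀ > 0, θ₀ > 0
such that for EVERY family of hard-sphere flows the local Gibbs laws with profiles (a₀, 0, θ₀) are
probability measures and their evolved empirical fields converge in probability to (ρ, ρu, E)(nτ) at
every node n ∈ ℕ. Proof: K, σ₁ from PureTonesExist; σ₁′ from LocalGibbsRealisation at K; η₀ from
NodeReturn; pick σ < min(σ₁, σ₁′) with 2Kσ³ ≤ η₀; continuity of ρ(0,·), θ(0,·) from
IsSmoothSpaceTimeOn.isSmooth_slice; u(0,·) = 0 by funext. [difficulty: provable-now]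
[TempleYoung2024, Spohn1991]

TWO-LAYER PLAN. Foreseen glued splits (none filed now; k ≤ 3, depth 1). ReturnDeficitVanishes ⇐
QuietStateReturn (order α⁰: steady capped data — hydrostatic quiet states u = 0, ∇p = 0, ∇θ ≠ 0 and
plane shears — D_N(t) → 0 for ALL t; the hydrostatic/shear rungs of cards
hydrostatic-thermal-rung-ttcf-variance, stationary-shear-rung as the base point) → AcousticEcho
(order α²: the two-time acoustic functional 𝒜_N(t) under the quiet-state law converges to TY's
Sturm–Liouville data (φ_k, ψ_k, ω_k) — linear inhomogeneous acoustics from Newton around a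
NON-uniform Euler-steady background, the microscopic counterpart of TY Cor. 1.2) →
ReturnDeficitVanishes, glue = analyticity/uniformity in the amplitude α (card Mechanism 6; consumer:
route AmplitudeAnalyticity with the quiet state as base point). PureTonesExist ⇐ HsEosConstitutive
(the hs EOS in TY's class on packing < η₀: v(p, s) smooth, v_p < 0, genuinely nonlinear; from
HsEosLowDensity) → SmoothTones (b-uniform amplitude range: tame/analytic IFT in TY's factorised
functional F = A·N, or propagation of regularity for the time-periodic solution) → PureTonesExist.
DeficitControlsFields ⇐ DiluteGibbsConcentration → StroboscopicIdentity → DeficitControlsFields,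
glue = the entropy-inequality step (KipnisLandim1999 App. 1 Prop. 8.2 with Mathlib's klDiv API; same
step as EntropyToFields 0769 but with the INITIAL law as reference, so no time-t local Gibbs
comparison state is ever built).

KILL CRITERIA. (a) ReturnDeficitVanishes refuted (Theorems/*Refutation: capped dilute τ-periodic
data, e.g. a tone or even a quiet state, with liminf_N D_N(nτ) > 0 for some n, or with the fields
provably not returning) ⇒ close --reason refuted:ReturnDeficitVanishes — it refutes the σ-uniform
conjunct for T = ∞ data, a first-rank NEGATIVE for HydrodynamicLimit (hand the witness to
KnudsenRate / FirstFailureBlowup). (b) PureTonesExist refuted because C^∞ fails while H^b tones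
exist ⇒ one restate: file the definition request IsHbHardSphereEulerSolution (finite-regularity
classical solutions) and restate PureTonesExist + the target over it (NodeReturn over C^∞ solutions
stays a consequence); refuted because the hs EOS is degenerate for TY (loss of genuine nonlinearity
/ resonance for every profile at small packing) ⇒ close refuted:PureTonesExist, the rung degenerates
to the steady rungs. (c) DeficitControlsFields refuted ⇒ only through failure of σ-uniform
exponential concentration under the cap: restate cruxes 2, 4 and the target profile-first (∀
profiles ∃σ₀) — weaker but then literally implied by HydrodynamicLimit; route survives. (d)
Mooted/superseded: a proof of HydrodynamicLimitFor σ for all σ below a cap-type threshold closes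
NodeReturn; close superseded --by that route, keeping StroboscopicIdentity/RungBites as the
benchmark record. (e) A proof that TY tones are linearly UNSTABLE with α-independent rate does NOT
kill any item (fixed n) but retires the Q ≍ N^(1/3) conjecture of § Not decomposed yet in favour of
a log N horizon.

NOT DECOMPOSED YET. Not items at open: (i) the QUALITY-FACTOR PAIR (card item 4): positive side
"NodeReturn uniformly in n ≤ n_N for every n_N = o(N^(1/3))" and the typed negative companion "for
non-uniform capped rest data and any t_N with t_N N^(−1/3) → ∞, liminf D_N(t_N) ≥ B_∞ > 0" (tone
absorbed AND quiet state thermally flattened: B_∞ = ⟨g₀, U₀ − U_eq⟩ > 0 is the Bregman gap to global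
equilibrium) — a candidate typed ¬(time-uniform HL) whose proof needs Navier–Stokes/heat-conduction
time scales of the deterministic gas (FouriersLaw territory), filed only after crux 2 or 4 moves;
(ii) the ALL-TIMES Bregman form D_N(t) → B(t) := ⟨g₀, P₀ − P_t⟩ = Bregman(P_t ‖ P₀) on [0, ∞) (card
crux 3, "HL in mean for one linear statistic"; its α²-part is AcousticEcho of the two-layer plan)
and the oscillating-correlation prediction C_N = D_N″ → B″ (meets HighMomentumCutoffBarrierNarrow
through the cubic energy current, unlike the node statements); (iii) evenness of D_N for rest data
and the anti-node identity H(f_(T/2) ‖ R f_(T/2)) = H(f_T ‖ f₀) (companion card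
loschmidt-is-zermelo-at-double-time); (iv) linear and transverse (3-D) stability of TY tones — open
PDE problems, irrelevant at fixed n; (v) the profile-first shadow of NodeReturn (trivial from
HydrodynamicLimit); (vi) rates and constants.

CHEAPEST FALSIFIER. (i) Lookup, DONE: TY print no C^∞/analytic regularity — arXiv:2406.00200 Thm 1.4
(p. 10) gives "continuous and piecewise H^b solutions", b > 5/2 arbitrary, α_k = α_k(b); so
PureTonesExist is a genuine crux (regularity upgrade) and the H^b restate is pre-planned (Kill
criteria (b)). (ii) Cheapest computation (not run: hub compute-free, no kit in this unit):
event-driven MD, N = 10⁵–10⁶ hard spheres on 𝕋³, packing πσ³/6 ∈ [0.02, 0.1], planar smooth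
two-level entropy profile, k = 1 tone of relative pressure amplitude α ≈ 0.05–0.1 prepared as rest
local-Gibbs data (a₀, 0, θ₀): track the pairings E[ρ_N(log a₀ − (3/2)log 2πθ₀)], E[e_N(1/θ₀)] over
5–20 periods; D_N(nτ) must decrease towards 0 with N at fixed n (expected residual ≍ n
N^(−1/3)σ^(−2)); an N-INDEPENDENT positive floor at n = 1 kills ReturnDeficitVanishes and the
conjunct for these data; D_N(t) < 0 anywhere exposes a coding error (ReturnDeficitNonneg is a
theorem). (iii) Free-flight control in the same code: the tone must phase-mix and never return
(D_N(τ) → B_free(τ) > 0) — the BoltzmannHypothesisBarrier kernel; the meter has teeth.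

NUMBERS. Scaling (conjunct): N+1 spheres of diameter ε_N = σ(N+1)^(−1/3) on the unit torus,
(N+1)ε_N³ = σ³, global packing πσ³/6, local packing ≈ ρ(x)πσ³/6 with ∫ρ = 1; mean free path ℓ ≈ (√2
π (N+1) ε_N² χ)⁻¹ ≍ N^(−1/3)σ^(−2) ⇒ Kn ≍ N^(−1/3): ≍ N^(1/3) collisions per particle per unit
macroscopic time for EVERY σ > 0. EOS: Z(η) = 1 + (2π/3)η + O(η²) (hsCompressibility docstring; B₂ =
2π/3 for unit diameter), activity expansion ρ = a(1 − 2B₂aσ³ + …) = a(1 − (4π/3)aσ³ + …): the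
activity-side and pressure-side first corrections differ by the factor 2, so for FIXED non-constant
profiles (a₀, θ₀) the matched Euler datum (ρ_eq[a₀; σ], 0, θ₀) is hydrostatic (ρθ₀Z(ρσ³) = const)
for at most one σ — the computation behind the σ-uniform capped quantifier form (an exact
special-data rung cannot be profile-first and σ-robust unless EOS-free: constant states, plane
shears). Cap: a₀σ³ ≤ η₀∫a₀ integrates to σ³ ≤ η₀. TY data (TempleYoung2024 Thms 1.3–1.4): k-mode p =
p̄ + α cos(ω_k t)φ_k(x) + O(α²), u = α sin(ω_k t)ψ_k(x) + O(α²), |α| < α_k, (φ_k, ψ_k, ω_k) from the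
Sturm–Liouville system (1.24) with σ_s = √(−v_p) = 1/c; non-resonance ω_j/ω_k ∉ ℚ (generic, Thm
1.5); symmetries (2.3)/(1.26): p even, u odd in t and in x (material frame). hs gas in TY variables:
e = 3θ/2, s = (3/2)log θ − log ρ − f_ex(ρσ³) + c, p(ρ, s) ∝ ρ^(5/3) Z(η) e^((2/3)f_ex(η)) e^(2s/3)
increasing in ρ at small η (v_p < 0, γ_eff → 5/3). Acoustic quality factor (heuristic,
Stokes–Kirchhoff): relative amplitude loss per period ≍ C k ℓ ≍ C k N^(−1/3)σ^(−2) ⇒ Q ≍ N^(1/3).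
Items at open: 12 (3 cruxes).

DEFINITION REQUESTS. None at open: every statement is over existing declarations
(IsHardSphereEulerSolution, localGibbsLaw, localGibbsProfile, empiricalMeasure,
HardSphereFlow.flow/lawAt, TendstoHydroFieldsAt, InformationTheory.klDiv,
hsExcessFreeEnergy/hsFreeVolume). Foreseen only under Kill criteria (b): IsHbHardSphereEulerSolution
(classical solutions of finite Sobolev regularity) in Literature/MathematicalPhysics/KineticTheory.
Bib: TempleYoung2024 (arXiv:2406.00200) and GlimmLax1970 (doi:10.1090/memo/0101) submitted with this
route (refs-add.bib); TempleYoung2023, Sasa2014, Yau1991, OllaVaradhanYau1993, KipnisLandim1999,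
Ruelle1969, LebowitzPenrose1964, PulvirentiTsagkarogiannis2012, Csiszar1975, Gaspard2022, GST2013,
CercignaniIllnerPulvirenti1994, Spohn1991 already in references.bib.

Novelty: Searches (2026-08-15): `lit search --source crossref "Temple Young time periodic solutions
compressible Euler nonlinear theory of sound"` (8: the TY programme 1996–2014, Tan–Wang MHD 2013,
Tsuge 2020 forced periodic — all PDE, none with particles); `lit search --source zbmath
"time-periodic solutions compressible Euler Temple Young"` (7: TY only, incl. arXiv:2305.15623,
arXiv:2406.00200); `lit search --source crossref "stroboscopic relative entropy hydrodynamic limit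
periodic solution recurrence Zermelo macroscopic"` (8; relevant: Varadhan 1993
doi:10.1007/978-1-4615-7909-0_37, Kosygina 2001 doi:10.1214/aop/1015345597 specific entropy along
the hydrodynamic evolution of GL models — stochastic, reference = time-t local Gibbs, no periodic
data); `lit galaxy search "time-periodic solutions compressible Euler" / "time periodic solutions of
the compressible Euler" / "nonlinear theory of sound" --star all` (0 / 0 / 4: Rozenberg ultrasonics,
Lighthill Waves in Fluids, Crighton et al. — classical attenuation only); `lit read
arxiv:2406.00200` pp. 1–9, 12, 15–21 (Thms 1.1, 1.3–1.5, Cor. 1.2, symmetries (2.3)/(2.7),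
constitutive law §2); local `lit search`/`--hybrid`, `lit frontier`, `lit bridges`, arXiv and
OpenAlex cascades UNAVAILABLE at filing (searchd rc 75; HTTP 429) — recorded in NOTES.md; the card's
own audited searches (refuter novelty audit 2026-08-15: arXiv, crossref, 134 cards, 5 routes) found
no source joining TY tones to kinetic theory or particle limits; board: 28 route  [refs: 10.1007/978-1-4615-7909-0_37, 10.1214/aop/1015345597, 2305.15623, 2406.00200, doi:10.1007/978-1-4615-7909-0_37, doi:10.1214/aop/1015345597, arxiv:2406.00200, Temple1985, TempleYoung2023, Sasa2014]

Barriers (technique_class: relative-entropy, special-data, time-periodic-reference): - technique_class: relative-entropy, special-data, time-periodic-reference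
- Literature.Barriers.AtomisticToContinuum.BoltzmannHypothesisBarrier: APPLIES to whatever proves
ReturnDeficitVanishes (some closure input is consumed) and is respected, not evaded: the rung
MINIMISES the input — convergence in mean of ONE linear statistic at countably many times — and its
formal kernel (free flight keeps every product law) is exactly why the ideal gas fails the rung at
the first node (the tone phase-mixes, D_N(τ) → B_free(τ) > 0): the statement has teeth.
- Literature.Barriers.AtomisticToContinuum.BoltzmannHypothesisBarrierNarrow: same; no
one-block/two-block replacement and no classification of stationary states is used in the identity,
the assembly or DeficitControlsFields (reference = the explicit initial law).
- Literature.Barriers.AtomisticToContinuum.HighMomentumCutoffBarrier: EVADED by the node statements: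
Λ pairs density against log a₀ − (3/2)log 2πθ₀, momentum against u₀/θ₀ and kinetic energy against
1/θ₀ — quadratic in v, dominated by the conserved energy, uniformly integrable; no cubic energy
CURRENT is ever exponentiated. Conceded for the all-times/oscillating-correlation upgrade of § Not
decomposed yet (ii), which meets the cubic heat current against ∇θ₀⁻¹ ≠ 0.
- Literature.Barriers.AtomisticToContinuum.HighMomentumCutoffBarrierNarrow: as above — (curr) is not
needed at the nodes; the entropy inequality in DeficitControlsFields is applied to FIELD deviation
events under

History (route lifecycle, newest last):
- 2026-08-15T13:46:16Z · CLOSED retired — not-a-thesis: assembly does not conclude the sub-problem Statement (operator:999:1257524)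

sub-problem: HydrodynamicLimit · status: closed(retired) · opened planner-plancard-AtomisticToContinuum-Hydrody-6193296a-0 2026-08-15T12:14:39Z · rev 0 · ledger route-AtomisticToContinuum-RingingRung
GENERATED by the gate from the ledger (D-0016/17). Provers cite these decls: `theorem foo : Summit.AtomisticToContinuum.HydrodynamicLimit.Theses.RingingRung.<Decl> := …` in Summits/AtomisticToContinuum/HydrodynamicLimit/Theorems/<Name>.lean.
-/

namespace Summit.AtomisticToContinuum.HydrodynamicLimit.Theses.RingingRung

open scoped BigOperators Topology Manifold Classical MeasureTheory ProbabilityTheory Matrix InnerProductSpace ComplexConjugate ContinuousMap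
open Filter Set Function TopologicalSpace MeasureTheory

attribute [summit_statement] _root_.HydrodynamicLimit

-- TODO item stmt-AtomisticToContinuum-7672 · target · rank 0 · closed · moot by None · by planner — BLOCKED: missing decl(s) PureTonesExist; restate via `ledger route edit` once they land:
--   def StroboscopicRung : Prop := open Literature.MathematicalPhysics.KineticTheory Literature.Analysis.FluidPDE MeasureTheory Filter Topology in PureTonesExist ∧ ∃ η₀ : ℝ, 0 < η₀ ∧ ∀ σ : ℝ, 0 < σ → ∀ (a₀ θ₀ : T3 → ℝ) (u₀ : T3 → V3), Continuous a₀ → Continuous θ₀ → Continuous u₀ → (∀ x, 0 < a₀ x) → (∀ x, 0 < θ₀ x) → (∀ x, a₀ x * σ ^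

/-- item stmt-AtomisticToContinuum-7664 · crux · rank 2 · closed · moot by None · by planner
why it might fail: It IS the conjunct for T = ∞ periodic data at the nodes (σ-uniform under the cap): false iff the deterministic gas attenuates or detunes a finite-amplitude tone by O(1) per period at Euler scale (anomalous sound absorption), or if σ-uniformity near η₀ fails.
sources: TempleYoung2024, arXiv:2406.00200, TempleYoung2023, Spohn1991, Yau1991, Sasa2014
[crux] THE RUNG IN ITS EXACT-METER FORM (card crux 1). There is η₀ > 0 such that for every σ > 0,
all continuous profiles a₀ > 0, u₀, θ₀ > 0 with a₀(x)σ³ ≤ η₀∫a₀, every τ > 0, every global classical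
hs-Euler solution (ρ, u, θ) that is τ-periodic in time, and every family of hard-sphere flows Φ_N:
if the local Gibbs laws P_N = localGibbsLaw σ a₀ u₀ θ₀ N (Φ N) are probability measures and their
time-0 fields converge to (ρ, ρu, E)(0), then for every n ∈ ℕ the return deficit D_N(nτ) := E_P_N[Λ]
− E_P_N[Λ ∘ flow(nτ)] → 0 as N → ∞, where Λ(z) = ∫ log(localGibbsProfile a₀ u₀ θ₀)
d(empiricalMeasure z) = (N+1)⁻¹ Σᵢ [log a₀(xᵢ) − (3/2)log 2πθ₀(xᵢ) − |vᵢ − u₀(xᵢ)|²/2θ₀(xᵢ)]. By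
StroboscopicIdentity this says exactly N⁻¹H(f_nτ ‖ f₀) → 0: the time-nτ law is indistinguishable
from the initial law by all local observables at specific-entropy resolution, while Φ_nτ z is
nowhere near z. [difficulty: open-problem] -/
@[route_item "route-AtomisticToContinuum-RingingRung"]
def ReturnDeficitVanishes : Prop :=
  open Literature.MathematicalPhysics.KineticTheory Literature.Analysis.FluidPDE MeasureTheory Filter Topology in ∃ η₀ : ℝ, 0 < η₀ ∧ ∀ σ : ℝ, 0 < σ → ∀ (a₀ θ₀ : T3 → ℝ) (u₀ : T3 → V3), Continuous a₀ → Continuous θ₀ → Continuous u₀ → (∀ x, 0 < a₀ x) → (∀ x, 0 < θ₀ x) → (∀ x, a₀ x * σ ^ 3 ≤ η₀ * ∫ y, a₀ y) → ∀ τ : ℝ, 0 < τ → ∀ (ρ θ : ℝ → T3 → ℝ) (u : ℝ → T3 → V3), (∀ T : ℝ, 0 < T → IsHardSphereEulerSolution σ T ρ u θ) → (∀ t x, ρ (t + τ) x = ρ t x ∧ u (t + τ) x = u t x ∧ θ (t + τ) x = θ t x) → ∀ Φ : (N : ℕ) → HardSphereFlow (Torus.geometry (Fin 3)) (hsDiameter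 σ N) (N + 1), let P : (N : ℕ) → Measure (Config (N + 1) (Fin 3) T3) := fun N => localGibbsLaw σ a₀ u₀ θ₀ N (Φ N); let D : ℕ → ℝ → ℝ := fun N t => (∫ z, (∫ y, Real.log (localGibbsProfile a₀ u₀ θ₀ y) ∂(empiricalMeasure z)) ∂(P N)) - ∫ z, (∫ y, Real.log (localGibbsProfile a₀ u₀ θ₀ y) ∂(empiricalMeasure ((Φ N).flow t z))) ∂(P N); (∀ N, IsProbabilityMeasure (P N)) → TendstoHydroFieldsAt P Φ ρ u θ 0 → ∀ n : ℕ, Tendsto (fun N => D N (n * τ)) atTop (𝓝 0)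

/-- item stmt-AtomisticToContinuum-7665 · crux · rank 3 · closed · moot by None · by planner
why it might fail: TY Thm 1.4 gives continuous piecewise-H^b tones for each b > 5/2 on |α| < α_k(b), not C^∞ at one fixed amplitude as IsHardSphereEulerSolution demands; needs a b-uniform (tame or analytic-class) IFT, Z analytic (HsEosLowDensity) and genuine nonlinearity of the hs EOS.
sources: TempleYoung2024, arXiv:2406.00200, TempleYoung2023, doi:10.4310/maa.2009.v16.n3.a5, doi:10.1007/s10915-014-9851-z, LebowitzPenrose1964
[crux] TEMPLE–YOUNG FOR THE HARD-SPHERE EQUATION OF STATE (card crux 2), in the conjunct's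
regularity. ∃ K > 0, σ₁ > 0 such that for every 0 < σ < σ₁ there are τ > 0 and (ρ, u, θ) with:
IsHardSphereEulerSolution σ T ρ u θ for every T > 0 (global, jointly C^∞, ρ, θ > 0); (ρ, u, θ)(t +
τ, ·) = (ρ, u, θ)(t, ·) for all t; u(0, ·) ≡ 0 (rest data: TY symmetry (2.3), p even / u odd in t);
not stationary (∃ t x, ρ(t, x) ≠ ρ(0, x)); ∫ρ(0) = 1; K⁻¹ ≤ ρ(0, ·), θ(0, ·) ≤ K uniformly in σ.
Intended construction: the hs EOS in TY's Lagrangian form v = v(p, s) (s = (3/2)log θ − log ρ −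
f_ex(ρσ³) + c, v_p < 0, genuinely nonlinear at small packing since Z → 1, γ = 5/3), a fixed smooth
1-periodic non-resonant entropy profile of x₁ (TY Thm 1.5 genericity), mode k, small amplitude α ≠
0, planar extension to 𝕋³; mass normalised to 1 (rescaling ρ ↦ λρ maps σ-solutions to
σλ^(−1/3)-solutions). [deps: HsEosLowDensity] [difficulty: L] -/
@[route_item "route-AtomisticToContinuum-RingingRung"]
def PureTonesExist : Prop :=
  open Literature.MathematicalPhysics.KineticTheory Literature.Analysis.FluidPDE MeasureTheory Filter Topology in ∃ K : ℝ, 0 < K ∧ ∃ σ₁ : ℝ, 0 < σ₁ ∧ ∀ σ : ℝ, 0 < σ → σ < σ₁ → ∃ τ : ℝ, 0 < τ ∧ ∃ (ρ θ : ℝ → T3 → ℝ) (u : ℝ → T3 → V3), (∀ T : ℝ, 0 < T → IsHardSphereEulerSolution σ T ρ u θ) ∧ (∀ t x, ρ (t + τ) x = ρ t x ∧ u (t + τ) x = u t x ∧ θ (t + τ) x = θ t x) ∧ (∀ x, u 0 x = 0) ∧ (∃ t x, ρ t x ≠ ρ 0 x) ∧ (∫ x, ρ 0 x = 1) ∧ ∀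 x, K⁻¹ ≤ ρ 0 x ∧ ρ 0 x ≤ K ∧ K⁻¹ ≤ θ 0 x ∧ θ 0 x ≤ K

/-- item stmt-AtomisticToContinuum-7666 · crux · rank 4 · closed · moot by None · by planner
why it might fail: Needs exponential (not polynomial) concentration of all three fields under canonical local Gibbs laws UNIFORMLY over the activity-capped class — η₀ must sit inside the canonical cluster-expansion radius — and klDiv(lawAt‖P₀) = (N+1)D exactly (lawAt ≪ P₀ via Liouville and a₀ > 0).
sources: KipnisLandim1999, Yau1991, OllaVaradhanYau1993, Ruelle1969, PulvirentiTsagkarogiannis2012, Csiszar1975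
[crux] A VANISHING DEFICIT PINS THE FIELDS (the ⇒ half of the card's "stroboscopic HL ⟺ D_N =
o(1)"). ∃ η₀ > 0 such that for every σ > 0, all continuous profiles a₀ > 0, u₀, θ₀ > 0 with a₀(x)σ³
≤ η₀∫a₀ and every family of flows: if the P_N are probability measures and D_N(t) → 0 at some time
t, then for every triple of limit profiles (r, w, ϑ), convergence in probability of the time-0
empirical fields to (∫χr, ∫χr·w, ∫χE(r, w, ϑ)) implies the same convergence for the fields of the
time-t configurations. Route: H(lawAt P_N t ‖ P_N) = (N+1)D_N(t) = o(N) (StroboscopicIdentity) +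
exponential concentration of the three fields under P_N, uniform over the capped class
(DiluteGibbsConcentration) + the entropy inequality μ(A) ≤ (log 2 + H(μ‖λ))/log(1 + 1/λ(A))
(KipnisLandim1999 App. 1 Prop. 8.2) with λ = P_N, μ = lawAt P_N t, and μ(field ∘ id ∈ ·) = P_N(field
∘ flow t ∈ ·) (measurable_flow). No dynamics beyond measure preservation. [deps:
StroboscopicIdentity, DiluteGibbsConcentration] [difficulty: M] -/
@[route_item "route-AtomisticToContinuum-RingingRung"]
def DeficitControlsFields : Prop :=
  open Literature.MathematicalPhysics.KineticTheory Literature.Analysis.FluidPDE MeasureTheory Filter Topology in ∃ η₀ : ℝ, 0 < η₀ ∧ ∀ σ : ℝ, 0 < σ → ∀ (a₀ θ₀ : T3 → ℝ) (u₀ : T3 → V3), Continuous a₀ → Continuous θ₀ → Continuous u₀ → (∀ x, 0 < a₀ x) → (∀ x, 0 < θ₀ x) → (∀ x, a₀ x * σ ^ 3 ≤ η₀ * ∫ y, a₀ y) → ∀ Φ : (N : ℕ) → HardSphereFlow (Torus.geometry (Fin 3)) (hsDiameter σ N) (N + 1), let P : (N : ℕ) → Measure (Config (N + 1) (Fin 3)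 T3) := fun N => localGibbsLaw σ a₀ u₀ θ₀ N (Φ N); let D : ℕ → ℝ → ℝ := fun N t => (∫ z, (∫ y, Real.log (localGibbsProfile a₀ u₀ θ₀ y) ∂(empiricalMeasure z)) ∂(P N)) - ∫ z, (∫ y, Real.log (localGibbsProfile a₀ u₀ θ₀ y) ∂(empiricalMeasure ((Φ N).flow t z))) ∂(P N); (∀ N, IsProbabilityMeasure (P N)) → ∀ t : ℝ, Tendsto (fun N => D N t) atTop (𝓝 0) → ∀ (r ϑ : T3 → ℝ) (w : T3 → V3), TendstoHydroFieldsAt P Φ (fun _ => r) (fun _ => w) (fun _ => ϑ) 0 → TendstoHydroFieldsAt P Φ (fun _ => r) (fun _ => w) (fun _ => ϑ) t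

/-- item stmt-AtomisticToContinuum-7667 · support · rank 9 · closed · moot by None · by planner
sources: Sasa2014, Gaspard2022, GST2013, Spohn1991
[support] THE EXACT METER (card Mechanism 1; one lemma for this card and its companion
loschmidt-is-zermelo-at-double-time). For σ > 0, continuous profiles a₀ > 0, u₀, θ₀ > 0, every N,
every hard-sphere flow Φ and every t ∈ ℝ: if P₀ = localGibbsLaw σ a₀ u₀ θ₀ N Φ is a probability
measure then klDiv (Φ.lawAt P₀ t) P₀ is finite and its real value equals (N+1)·(E_P₀[Λ] − E_P₀[Λ ∘
Φ.flow t]). Proof: P₀ = Z⁻¹𝟙_D ∏ g₀(zᵢ) dz with log ∏ g₀ = (N+1)Λ; lawAt P₀ t = (f₀ ∘ Φ_(−t)) dz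
(lawAt_withDensity, measurePreserving); H = ∫ f_t log f_t − ∫ f_t log f₀ = ∫ f₀ log f₀ − ∫ f_t log
f₀ (Liouville) = (N+1)(E₀Λ − E_tΛ), log Z cancelling; integrability from Gaussian velocity moments
and energy conservation (configEnergy_eq). [difficulty: M] -/
@[route_item "route-AtomisticToContinuum-RingingRung"]
def StroboscopicIdentity : Prop :=
  open Literature.MathematicalPhysics.KineticTheory Literature.Analysis.FluidPDE MeasureTheory Filter Topology in ∀ σ : ℝ, 0 < σ → ∀ (a₀ θ₀ : T3 → ℝ) (u₀ : T3 → V3), Continuous a₀ → Continuous θ₀ → Continuous u₀ → (∀ x, 0 < a₀ x) → (∀ x, 0 < θ₀ x) → ∀ (N : ℕ) (Φ : HardSphereFlow (Torus.geometry (Fin 3)) (hsDiameter σ N) (N + 1)), IsProbabilityMeasure (localGibbsLaw σ a₀ u₀ θ₀ N Φ) → ∀ t : ℝ, InformationTheory.klDiv (Φ.lawAt (localGibbsLaw σ a₀ u₀ θ₀ N Φ) t) (localGibbsLaw σ a₀ u₀ θ₀ N Φ) ≠ ⊤ ∧ (InformationTheory.klDiv (Φ.lawAt (localGibbsLaw σ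 a₀ u₀ θ₀ N Φ) t) (localGibbsLaw σ a₀ u₀ θ₀ N Φ)).toReal = ((N : ℝ) + 1) * ((∫ z, (∫ y, Real.log (localGibbsProfile a₀ u₀ θ₀ y) ∂(empiricalMeasure z)) ∂(localGibbsLaw σ a₀ u₀ θ₀ N Φ)) - ∫ z, (∫ y, Real.log (localGibbsProfile a₀ u₀ θ₀ y) ∂(empiricalMeasure (Φ.flow t z))) ∂(localGibbsLaw σ a₀ u₀ θ₀ N Φ))

/-- item stmt-AtomisticToContinuum-7668 · support · rank 9 · closed · moot by None · by planner
sources: Csiszar1975, Sasa2014, GST2013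
[support] TEETH AT FINITE N: for the same data and every t, 0 ≤ D_N(t) = E_P₀[Λ] − E_P₀[Λ ∘ Φ.flow
t] (Gibbs' inequality E_f_t[log f₀] ≤ E_f_t[log f_t] = E_f₀[log f₀]; corollary of
StroboscopicIdentity). The MD-checkable positivity of the "initial dissipation function"; with rest
data t ↦ D_N(t) is moreover even (velocity reversal), recorded not filed. [difficulty: provable-now] -/
@[route_item "route-AtomisticToContinuum-RingingRung"]
def ReturnDeficitNonneg : Prop :=
  open Literature.MathematicalPhysics.KineticTheory Literature.Analysis.FluidPDE MeasureTheory Filter Topology in ∀ σ : ℝ, 0 < σ → ∀ (a₀ θ₀ : T3 → ℝ) (u₀ : T3 → V3), Continuous a₀ → Continuous θ₀ → Continuous u₀ → (∀ x, 0 < a₀ x) → (∀ x, 0 < θ₀ x) → ∀ (N : ℕ) (Φ : HardSphereFlow (Torus.geometry (Fin 3)) (hsDiameter σ N) (N + 1)), IsProbabilityMeasure (localGibbsLaw σ a₀ u₀ θ₀ N Φ) → ∀ t : ℝ, 0 ≤ (∫ z, (∫ y, Real.log (localGibbsProfile a₀ u₀ θ₀ y) ∂(empiricalMeasure z)) ∂(localGibbsLaw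 σ a₀ u₀ θ₀ N Φ)) - ∫ z, (∫ y, Real.log (localGibbsProfile a₀ u₀ θ₀ y) ∂(empiricalMeasure (Φ.flow t z))) ∂(localGibbsLaw σ a₀ u₀ θ₀ N Φ)

/-- item stmt-AtomisticToContinuum-7669 · support · rank 9 · closed · moot by None · by planner
sources: Spohn1991, OllaVaradhanYau1993
[support] THE ⇐ HALF (no cap, no small σ): for σ > 0, continuous profiles, any flows with P_N
probability measures, any t and any limit profiles (r, w, ϑ): if the empirical fields converge in
probability to (∫χr, ∫χr·w, ∫χE(r,w,ϑ)) both at time 0 and at time t, then D_N(t) → 0. Λ is the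
density field against log a₀ − (3/2)log 2πθ₀ − |u₀|²/2θ₀, plus the momentum field against u₀/θ₀,
minus the energy field against 1/θ₀ (all continuous weights); expectations converge by uniform
integrability, which energy conservation (Σ|vᵢ(t)|² = Σ|vᵢ(0)|²) transfers from the Gaussian time-0
law. Hence NodeReturn ⟹ ReturnDeficitVanishes: the two forms of the rung are equivalent.
[difficulty: M] -/
@[route_item "route-AtomisticToContinuum-RingingRung"]
def FieldsControlDeficit : Prop :=
  open Literature.MathematicalPhysics.KineticTheory Literature.Analysis.FluidPDE MeasureTheory Filter Topology in ∀ σ : ℝ, 0 < σ → ∀ (a₀ θ₀ : T3 → ℝ) (u₀ : T3 → V3), Continuous a₀ → Continuous θ₀ → Continuous u₀ → (∀ x, 0 < a₀ x) → (∀ x, 0 < θ₀ x) → ∀ Φ : (N : ℕ) → HardSphereFlow (Torus.geometry (Fin 3)) (hsDiameter σ N) (N + 1), let P : (N : ℕ) → Measure (Config (N + 1) (Fin 3) T3) := fun N => localGibbsLaw σ a₀ u₀ θ₀ N (Φ N); let D : ℕ → ℝ → ℝ := fun N t => (∫ z, (∫ y, Real.log (localGibbsProfile a₀ u₀ θ₀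 y) ∂(empiricalMeasure z)) ∂(P N)) - ∫ z, (∫ y, Real.log (localGibbsProfile a₀ u₀ θ₀ y) ∂(empiricalMeasure ((Φ N).flow t z))) ∂(P N); (∀ N, IsProbabilityMeasure (P N)) → ∀ (t : ℝ) (r ϑ : T3 → ℝ) (w : T3 → V3), TendstoHydroFieldsAt P Φ (fun _ => r) (fun _ => w) (fun _ => ϑ) 0 → TendstoHydroFieldsAt P Φ (fun _ => r) (fun _ => w) (fun _ => ϑ) t → Tendsto (fun N => D N t) atTop (𝓝 0)

/-- item stmt-AtomisticToContinuum-7670 · support · rank 9 · closed · moot by None · by planner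
sources: Ruelle1969, LebowitzPenrose1964, PulvirentiTsagkarogiannis2012, Spohn1991
[support] σ-UNIFORM EXPONENTIAL LLN FOR DILUTE LOCAL GIBBS LAWS (capped twin of
LocalGibbsConcentration 0767, which is profile-first): ∃ η₀ > 0, ∀ σ > 0, for all continuous a > 0,
u₀, θ₀ > 0 with a(x)σ³ ≤ η₀∫a there is a continuous ρ₀ > 0 (equilibrium density at activity a,
diameter σ) such that the laws localGibbsLaw σ a u₀ θ₀ N Φ are probability measures for all N, Φ and
P(|field − limit| > δ) ≤ C e^(−(N+1)/C) for the density, momentum and energy fields against every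
continuous χ, C = C(χ, δ, profiles) uniform in N and Φ. Canonical cluster expansion at packing ≲ η₀
(integrating the cap gives σ³ ≤ η₀) + Gaussian velocities. [difficulty: L] -/
@[route_item "route-AtomisticToContinuum-RingingRung"]
def DiluteGibbsConcentration : Prop :=
  open Literature.MathematicalPhysics.KineticTheory Literature.Analysis.FluidPDE MeasureTheory Filter Topology in ∃ η₀ : ℝ, 0 < η₀ ∧ ∀ σ : ℝ, 0 < σ → ∀ (a θ₀ : T3 → ℝ) (u₀ : T3 → V3), Continuous a → Continuous θ₀ → Continuous u₀ → (∀ x, 0 < a x) → (∀ x, 0 < θ₀ x) → (∀ x, a x * σ ^ 3 ≤ η₀ * ∫ y, a y) → ∃ ρ₀ : T3 → ℝ, Continuous ρ₀ ∧ (∀ x, 0 < ρ₀ x) ∧ (∀ (N : ℕ) (Φ : HardSphereFlow (Torus.geometry (Fin 3)) (hsDiameter σ N) (N + 1)), IsProbabilityMeasure (localGibbsLaw σ a u₀ θ₀ N Φ)) ∧ ∀ χ : T3 → ℝ, Continuous χ → ∀ δ : ℝ, 0 < δ → ∃ C : ℝ, 0 < C ∧ ∀ (N : ℕ) (Φ :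 HardSphereFlow (Torus.geometry (Fin 3)) (hsDiameter σ N) (N + 1)), localGibbsLaw σ a u₀ θ₀ N Φ {z | δ < |empiricalDensityField z χ - ∫ x, χ x * ρ₀ x|} ≤ ENNReal.ofReal (C * Real.exp (-(C⁻¹ * (N + 1)))) ∧ localGibbsLaw σ a u₀ θ₀ N Φ {z | δ < ‖empiricalMomentumField z χ - ∫ x, (χ x * ρ₀ x) • u₀ x‖} ≤ ENNReal.ofReal (C * Real.exp (-(C⁻¹ * (N + 1)))) ∧ localGibbsLaw σ a u₀ θ₀ N Φ {z | δ < |empiricalEnergyField z χ - ∫ x, χ x * totalEnergyDensity (ρ₀ x) (u₀ x) (θ₀ x)|} ≤ ENNReal.ofReal (C * Real.exp (-(C⁻¹ * (N + 1))))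

/-- item stmt-AtomisticToContinuum-7671 · support · rank 9 · closed · moot by None · by planner
sources: PulvirentiTsagkarogiannis2012, LebowitzPenrose1964, Ruelle1969
[support] INVERSE LLN (every bounded continuous state is dilute local-Gibbs data, uniformly): ∀ K >
0 ∃ σ₁ > 0 ∀ 0 < σ < σ₁, for all continuous (ρ₀, u₀, θ₀) with K⁻¹ ≤ ρ₀ ≤ K, ∫ρ₀ = 1, θ₀ > 0 there is
a continuous activity a₀ > 0 with a₀ ≤ 2K∫a₀ such that for every family of flows the laws
localGibbsLaw σ a₀ u₀ θ₀ N (Φ N) are probability measures and their time-0 fields converge in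
probability to (ρ₀, ρ₀u₀, ρ₀(|u₀|²/2 + 3θ₀/2)). Inversion of the density–activity series ρ = a(1 −
(4π/3)aσ³ + …) (canonical, normalised) by contraction, uniform on the K-class; with
DiluteGibbsConcentration it certifies that the tones of PureTonesExist are admissible capped data
for σ small (RungBites). [difficulty: M] -/
@[route_item "route-AtomisticToContinuum-RingingRung"]
def LocalGibbsRealisation : Prop :=
  open Literature.MathematicalPhysics.KineticTheory Literature.Analysis.FluidPDE MeasureTheory Filter Topology in ∀ K : ℝ, 0 < K → ∃ σ₁ : ℝ, 0 < σ₁ ∧ ∀ σ : ℝ, 0 < σ → σ < σ₁ → ∀ (ρ₀ θ₀ : T3 → ℝ) (u₀ : T3 → V3), Continuous ρ₀ → Continuous θ₀ → Continuous u₀ → (∀ x, K⁻¹ ≤ ρ₀ x ∧ ρ₀ x ≤ K) → (∫ x, ρ₀ x = 1) → (∀ x, 0 < θ₀ x) → ∃ a₀ : T3 → ℝ, Continuous a₀ ∧ (∀ x, 0 < a₀ x) ∧ (∀ x, a₀ x ≤ 2 * K * ∫ y, a₀ y) ∧ ∀ Φ : (N : ℕ) → HardSphereFlow (Torus.geometry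 (Fin 3)) (hsDiameter σ N) (N + 1), (∀ N, IsProbabilityMeasure (localGibbsLaw σ a₀ u₀ θ₀ N (Φ N))) ∧ TendstoHydroFieldsAt (fun N => localGibbsLaw σ a₀ u₀ θ₀ N (Φ N)) Φ (fun _ => ρ₀) (fun _ => u₀) (fun _ => θ₀) 0

-- TODO item stmt-AtomisticToContinuum-7673 · support · rank 9 · closed · moot by None · by planner — BLOCKED: missing decl(s) StroboscopicRung; restate via `ledger route edit` once they land:
--   def RungBites : Prop := open Literature.MathematicalPhysics.KineticTheory Literature.Analysis.FluidPDE MeasureTheory Filter Topology in StroboscopicRung → LocalGibbsRealisation → ∃ σ τ : ℝ, 0 < σ ∧ 0 < τ ∧ ∃ (ρ θ : ℝ → T3 → ℝ) (u : ℝ → T3 → V3) (a₀ θ₀ : T3 → ℝ), (∀ T : ℝ, 0 < T → IsHardSphereEulerSolution σ T ρ u θ) ∧ (∀ t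

-- TODO item stmt-AtomisticToContinuum-7674 · assembly · rank 1 · closed · moot by None · by planner — BLOCKED: missing decl(s) StroboscopicRung; restate via `ledger route edit` once they land:
--   def Assembly : Prop := DeficitControlsFields → ReturnDeficitVanishes → PureTonesExist → StroboscopicRung

end Summit.AtomisticToContinuum.HydrodynamicLimit.Theses.RingingRung
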